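import Mathlib
import Literature.MathematicalPhysics.QuantumFieldTheory.Balaban1983to89.T3YM3TorusStatement
import Literature.MathematicalPhysics.QuantumFieldTheory.Balaban1983to89.T3NestedUnitLaws
import Literature.MathematicalPhysics.QuantumFieldTheory.Balaban1983to89.T3UnitLawDensityEML
import Literature.MathematicalPhysics.QuantumFieldTheory.Balaban1983to89.BalabanUVClass
import Literature.MathematicalPhysics.QuantumFieldTheory.Balaban1983to89.T3UnitScaleTilt

/-!
# Route `BackwardLiouvilleRigidity`, support `FlatRatioTermination` (stmt-QuantumFields-22542) — registered stub `stub_windowTV`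

The single-height TOTAL-VARIATION bound of the planner's skeleton `Cruxes/FluctuationComparisonRegPrIntL/Lines/flat_ratio_termination.lean`
(ym-r3-idea-1 g10, sha 45959ca5), uniform in the lattice.  At one height: `μ = Haar·ρ`, `μ' = Haar·ρ'` probability laws with `ρ, ρ' > 0`
on the window `S = {PlaqSmall θ}`; every configuration of the inner window `G = {PlaqSmall θin}` is joined to the trivial configuration
by a chain of `≤ D` one-bond moves inside `S`; the one-bond oscillation of `r = log ρ − log ρ'` on `S` is `≤ τ` with `τ·D ≤ δ₀`; and both
laws give mass `≤ ηr ≤ δ₀` to `Gᶜ`.  Then `|μ A − μ' A| ≤ ε` for every measurable `A`, once `δ₀ = min (1/2) (ε/11)`.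

Proof.  Telescoping along the chain, `|r U − r 1| ≤ D τ ≤ δ₀` on `G` (`abs_sub_le_mul_of_chain`), so `ρ ≤ K₁ ρ'` and `ρ' ≤ K₂ ρ` on `G`
with `K₁ K₂ = e^{2δ₀}`; integrating, `μ(B ∩ G) ≤ K₁ μ'(B ∩ G)` and `μ'(B ∩ G) ≤ K₂ μ(B ∩ G)` (`measureReal_inter_le_mul`); with `B = univ`
and the tails, `K₁, K₂ ≥ 1 − δ₀`, hence `K₁, K₂ ≤ e^{2δ₀}/(1 − δ₀) ≤ 1 + 10 δ₀` (`δ₀ ≤ 1/2`); so `|μ(A ∩ G) − μ'(A ∩ G)| ≤ 10 δ₀` and the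
two tails add `≤ δ₀`.

HONEST SCOPE.  One of three registered stubs of a SUPPORT item; the geometric stub `stub_innerWindowChains` and the crux
`ClassLimitTrajectories` stay open; no rung (R3 is a RECORD rung), no summit statement and nothing about the Yang–Mills mass gap is
proved here.
-/

namespace Summit.QuantumFields.YangMills.Theorems.FlatRatioTermination

open MeasureTheory Filter Topology
open Literature.MathematicalPhysics.QuantumFieldTheory.Balaban1983to89
open Literature.MathematicalPhysics.QuantumFieldTheory.Balaban1983to89.T3ContinuumYM3Torus
open Literature.MathematicalPhysics.QuantumFieldTheory.Balaban1983to89.T3NestedUnitLaws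
open Literature.MathematicalPhysics.QuantumFieldTheory.Balaban1983to89.T3UnitLawDensityEML

/-! ## §1 Telescoping along a one-bond chain -/

/-- TELESCOPING ALONG A ONE-BOND CHAIN: if `|r U − r V| ≤ τ` whenever `U, V ∈ S` differ in at most one bond, then along a chain
`W 0, …, W n` inside `S` with one-bond steps, `|r (W i) − r (W 0)| ≤ i·τ` for `i ≤ n`. [folklore] -/
theorem abs_sub_le_mul_of_chain {B Gp : Type*} (S : Set (B → Gp)) (r : (B → Gp) → ℝ) (τ : ℝ)
    (hosc : ∀ (b : B) (U V : B → Gp), U ∈ S → V ∈ S → (∀ e, e ≠ b → U e = V e) → |r U - r V| ≤ τ)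
    (W : ℕ → B → Gp) (n : ℕ) (hS : ∀ i, i ≤ n → W i ∈ S)
    (hstep : ∀ i, i < n → ∃ b : B, ∀ e, e ≠ b → W i e = W (i + 1) e) :
    ∀ i, i ≤ n → |r (W i) - r (W 0)| ≤ (i : ℝ) * τ := by
  intro i
  induction i with
  | zero => intro _; simp
  | succ i ih =>
    intro hi
    have hi' : i < n := Nat.lt_of_succ_le hi
    obtain ⟨b, hb⟩ := hstep i hi'
    have h1 : |r (W (i + 1)) - r (W i)| ≤ τ := by
      rw [abs_sub_comm]
      exact hosc b (W i) (W (i + 1)) (hS i hi'.le) (hS (i + 1) hi) hb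
    have h2 := ih hi'.le
    calc |r (W (i + 1)) - r (W 0)| = |(r (W (i + 1)) - r (W i)) + (r (W i) - r (W 0))| := by ring_nf
      _ ≤ |r (W (i + 1)) - r (W i)| + |r (W i) - r (W 0)| := abs_add_le _ _
      _ ≤ τ + (i : ℝ) * τ := add_le_add h1 h2
      _ = ((i + 1 : ℕ) : ℝ) * τ := by push_cast; ring

/-! ## §2 Integrating a pointwise density comparison -/

/-- INTEGRATING A DENSITY COMPARISON: if `ρ ≤ K·ρ'` on a measurable `C` (`K ≥ 0`), then `(ν·ρ)(C) ≤ K·(ν·ρ')(C)` in real mass, for a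
finite `ν·ρ'`. [folklore] -/
theorem measureReal_le_mul_of_density_le {α : Type*} [MeasurableSpace α] (ν μ μ' : Measure α) (ρ ρ' : α → ℝ)
    (hμ : μ = ν.withDensity fun x => ENNReal.ofReal (ρ x)) (hμ' : μ' = ν.withDensity fun x => ENNReal.ofReal (ρ' x))
    [IsFiniteMeasure μ'] {C : Set α} (hC : MeasurableSet C) {K : ℝ} (hK : 0 ≤ K) (h : ∀ x ∈ C, ρ x ≤ K * ρ' x) :
    μ.real C ≤ K * μ'.real C := by
  have hfin : μ' C ≠ ⊤ := measure_ne_top μ' C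
  have h1 : μ C ≤ ENNReal.ofReal K * μ' C := by
    rw [hμ, hμ', withDensity_apply _ hC, withDensity_apply _ hC, ← lintegral_const_mul' _ _ ENNReal.ofReal_ne_top]
    refine setLIntegral_mono' hC fun x hx => ?_
    rw [← ENNReal.ofReal_mul hK]
    exact ENNReal.ofReal_le_ofReal (h x hx)
  have h2 : ENNReal.ofReal K * μ' C ≠ ⊤ := ENNReal.mul_ne_top ENNReal.ofReal_ne_top hfin
  calc μ.real C = (μ C).toReal := measureReal_def _ _
    _ ≤ (ENNReal.ofReal K * μ' C).toReal := ENNReal.toReal_mono h2 h1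
    _ = K * μ'.real C := by rw [ENNReal.toReal_mul, ENNReal.toReal_ofReal hK, measureReal_def]

/-! ## §3 The elementary inequality -/

/-- `e^{2δ}/(1 − δ) − 1 ≤ 10 δ` for `0 ≤ δ ≤ 1/2`. [folklore] -/
theorem exp_two_mul_div_sub_one_le {δ : ℝ} (h0 : 0 ≤ δ) (h1 : δ ≤ 1 / 2) :
    Real.exp (2 * δ) / (1 - δ) - 1 ≤ 10 * δ := by
  have hexp : Real.exp (2 * δ) ≤ 1 + 4 * δ := by
    have habs : |2 * δ| ≤ 1 := by rw [abs_of_nonneg (by linarith)]; linarith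
    have := Real.abs_exp_sub_one_le habs
    rw [abs_of_nonneg (by linarith : (0 : ℝ) ≤ 2 * δ)] at this
    have := (abs_le.mp this).2
    linarith
  have hpos : 0 < 1 - δ := by linarith
  rw [div_sub_one hpos.ne', div_le_iff₀ hpos]
  nlinarith

/-! ## §4 The registered stub -/

/-- **REGISTERED STUB `stub_windowTV`** of the skeleton for `FlatRatioTermination` (stmt-QuantumFields-22542), verbatim: the
single-height total-variation bound from inner-window chains, one-bond oscillation and inner tails (`δ₀ = min (1/2) (ε/11)`). [folklore] -/
theorem stub_windowTV : open MeasureTheory Filter Topology Literature.MathematicalPhysics.QuantumFieldTheory.Balaban1983to89 T3ContinuumYM3Torus T3NestedUnitLaws T3UnitLawDensityEML T4Continuum BalabanUVClass T3UnitScaleTilt in ∀ ε : ℝ, 0 < ε → ∃ δ₀ : ℝ, 0 < δ₀ ∧ ∀ (F : T3Family) (j D : ℕ) (θin θ τ ηr : ℝ), 0 < θin → 0 ≤ τ → τ * (D : ℝ) ≤ δ₀ → 0 ≤ ηr → ηr ≤ δ₀ → ∀ (μ μ' : MeasureTheory.Measure (GaugeField (F.P j) 0 ↥(Matrix.specialUnitaryGroup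 (Fin 2) ℂ))) (ρ ρ' : GaugeField (F.P j) 0 ↥(Matrix.specialUnitaryGroup (Fin 2) ℂ) → ℝ), IsProbabilityMeasure μ → IsProbabilityMeasure μ' → (∀ U, PlaqSmall θ U → 0 < ρ U ∧ 0 < ρ' U) → μ = (fieldMeasure _ _ _).withDensity (fun U => ENNReal.ofReal (ρ U)) → μ' = (fieldMeasure _ _ _).withDensity (fun U => ENNReal.ofReal (ρ' U)) → (∀ U : GaugeField (F.P j) 0 ↥(Matrix.specialUnitaryGroup (Fin 2) ℂ), PlaqSmall (θin) U → ∃ (n : ℕ) (W : ℕ → GaugeField (F.P j) 0 ↥(Matrix.specialUnitaryGroup (Fin 2) ℂ)), n ≤ D ∧ (∀ e, W 0 e = 1) ∧ W n = U ∧ (∀ i, i ≤ n → PlaqSmall (θ) (W i)) ∧ (∀ i, i < n → ∃ b : PBond (F.P j) 0, ∀ e, e ≠ b → W i e = W (i + 1) e)) → (∀ (b : PBond (F.P j) 0) U V, PlaqSmall θ U → PlaqSmall θ V → (∀ e, e ≠ b → U e = V e) → |(Real.log (ρ U) - Real.log (ρ' U)) - (Real.log (ρ V) - Real.log (ρ'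 V))| ≤ τ) → μ {U | ¬ PlaqSmall θin U} ≤ ENNReal.ofReal ηr → μ' {U | ¬ PlaqSmall θin U} ≤ ENNReal.ofReal ηr → ∀ A : Set (GaugeField (F.P j) 0 ↥(Matrix.specialUnitaryGroup (Fin 2) ℂ)), MeasurableSet A → |μ.real A - μ'.real A| ≤ ε := by
  intro ε hε
  refine ⟨min (1 / 2) (ε / 11), lt_min (by norm_num) (by positivity), ?_⟩
  intro F j D θin θ τ ηr _hθin hτ hτD hηr hηrδ μ μ' ρ ρ' hμP hμ'P hpos hμ hμ' hchain hosc htail htail' A hA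
  set δ₀ : ℝ := min (1 / 2) (ε / 11) with hδ₀def
  have hδ₀half : δ₀ ≤ 1 / 2 := min_le_left _ _
  have hδ₀ε : δ₀ ≤ ε / 11 := min_le_right _ _
  have hδ₀nn : 0 ≤ δ₀ := hηr.trans hηrδ
  -- the window, the inner window, the log-ratio and its value at the trivial configuration
  set S : Set (GaugeField (F.P j) 0 ↥(Matrix.specialUnitaryGroup (Fin 2) ℂ)) := {U | PlaqSmall θ U} with hSdef
  set G : Set (GaugeField (F.P j) 0 ↥(Matrix.specialUnitaryGroup (Fin 2) ℂ)) := {U | PlaqSmall θin U} with hGdef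
  have hG : MeasurableSet G := T3UnitScaleTilt.measurableSet_plaqSmall θin
  set r : GaugeField (F.P j) 0 ↥(Matrix.specialUnitaryGroup (Fin 2) ℂ) → ℝ := fun U => Real.log (ρ U) - Real.log (ρ' U)
    with hrdef
  set one : GaugeField (F.P j) 0 ↥(Matrix.specialUnitaryGroup (Fin 2) ℂ) := fun _ => 1 with honedef
  set r₁ : ℝ := r one with hr₁def
  -- §1 on the inner window: inside the window, and the log-ratio is within `δ₀` of its value at `1`
  have hstep1 : ∀ U ∈ G, U ∈ S ∧ |r U - r₁| ≤ δ₀ := by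
    intro U hU
    obtain ⟨n, W, hn, hW0, hWn, hWS, hWst⟩ := hchain U hU
    have hW0' : W 0 = one := funext hW0
    have hUS : U ∈ S := by rw [← hWn]; exact hWS n le_rfl
    refine ⟨hUS, ?_⟩
    have hch := abs_sub_le_mul_of_chain S r τ
      (fun b U V hU hV hUV => hosc b U V hU hV hUV) W n (fun i hi => hWS i hi) hWst n le_rfl
    rw [hWn, hW0'] at hch
    calc |r U - r₁| ≤ (n : ℝ) * τ := hch
      _ ≤ (D : ℝ) * τ := mul_le_mul_of_nonneg_right (by exact_mod_cast hn) hτ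
      _ = τ * D := mul_comm _ _
      _ ≤ δ₀ := hτD
  -- §2 pointwise density comparison on the inner window
  set K₁ : ℝ := Real.exp (r₁ + δ₀) with hK₁def
  set K₂ : ℝ := Real.exp (δ₀ - r₁) with hK₂def
  have hK₁pos : 0 < K₁ := Real.exp_pos _
  have hK₂pos : 0 < K₂ := Real.exp_pos _
  have hK₁K₂ : K₁ * K₂ = Real.exp (2 * δ₀) := by
    rw [hK₁def, hK₂def, ← Real.exp_add]; ring_nf
  have hcmp : ∀ U ∈ G, ρ U ≤ K₁ * ρ' U ∧ ρ' U ≤ K₂ * ρ U := by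
    intro U hU
    obtain ⟨hUS, hr⟩ := hstep1 U hU
    obtain ⟨hρ, hρ'⟩ := hpos U hUS
    have hr' := abs_le.mp hr
    constructor
    · have : Real.log (ρ U) ≤ Real.log (ρ' U) + (r₁ + δ₀) := by
        have := hr'.2; simp only [hrdef] at this; linarith
      calc ρ U = Real.exp (Real.log (ρ U)) := (Real.exp_log hρ).symm
        _ ≤ Real.exp (Real.log (ρ' U) + (r₁ + δ₀)) := Real.exp_le_exp.mpr this
        _ = K₁ * ρ' U := by rw [Real.exp_add, Real.exp_log hρ', hK₁def, mul_comm]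
    · have : Real.log (ρ' U) ≤ Real.log (ρ U) + (δ₀ - r₁) := by
        have := hr'.1; simp only [hrdef] at this; linarith
      calc ρ' U = Real.exp (Real.log (ρ' U)) := (Real.exp_log hρ').symm
        _ ≤ Real.exp (Real.log (ρ U) + (δ₀ - r₁)) := Real.exp_le_exp.mpr this
        _ = K₂ * ρ U := by rw [Real.exp_add, Real.exp_log hρ, hK₂def, mul_comm]
  -- §3 integrated comparisons on `C ∩ G`
  have hint : ∀ C, MeasurableSet C → μ.real (C ∩ G) ≤ K₁ * μ'.real (C ∩ G) ∧ μ'.real (C ∩ G) ≤ K₂ * μ.real (C ∩ G) := by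
    intro C hC
    exact ⟨measureReal_le_mul_of_density_le _ μ μ' ρ ρ' hμ hμ' (hC.inter hG) hK₁pos.le fun x hx => (hcmp x hx.2).1,
      measureReal_le_mul_of_density_le _ μ' μ ρ' ρ hμ' hμ (hC.inter hG) hK₂pos.le fun x hx => (hcmp x hx.2).2⟩
  -- §4 tails: the inner window has mass `≥ 1 − δ₀` under both laws
  have hGc : Gᶜ = {U | ¬ PlaqSmall θin U} := by rw [hGdef, Set.compl_setOf]
  have htailR : μ.real Gᶜ ≤ δ₀ := by
    rw [measureReal_def, hGc]
    calc (μ {U | ¬ PlaqSmall θin U}).toReal ≤ (ENNReal.ofReal ηr).toReal := ENNReal.toReal_mono ENNReal.ofReal_ne_top htail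
      _ = ηr := ENNReal.toReal_ofReal hηr
      _ ≤ δ₀ := hηrδ
  have htailR' : μ'.real Gᶜ ≤ δ₀ := by
    rw [measureReal_def, hGc]
    calc (μ' {U | ¬ PlaqSmall θin U}).toReal ≤ (ENNReal.ofReal ηr).toReal := ENNReal.toReal_mono ENNReal.ofReal_ne_top htail'
      _ = ηr := ENNReal.toReal_ofReal hηr
      _ ≤ δ₀ := hηrδ
  have hmG : 1 - δ₀ ≤ μ.real G := by
    have := measureReal_add_measureReal_compl (μ := μ) hG
    rw [probReal_univ] at this
    linarith
  have hmG' : 1 - δ₀ ≤ μ'.real G := by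
    have := measureReal_add_measureReal_compl (μ := μ') hG
    rw [probReal_univ] at this
    linarith
  have hmG1 : μ.real G ≤ 1 := measureReal_le_one
  have hmG1' : μ'.real G ≤ 1 := measureReal_le_one
  -- §5 the constants are pinned: `1 − δ₀ ≤ K₁, K₂ ≤ e^{2δ₀}/(1 − δ₀)`
  obtain ⟨hGK₁, hGK₂⟩ := hint Set.univ MeasurableSet.univ
  rw [Set.univ_inter] at hGK₁ hGK₂
  have hK₁lb : 1 - δ₀ ≤ K₁ := by
    have h1 : K₁ * μ'.real G ≤ K₁ * 1 := mul_le_mul_of_nonneg_left hmG1' hK₁pos.le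
    linarith
  have hK₂lb : 1 - δ₀ ≤ K₂ := by
    have h1 : K₂ * μ.real G ≤ K₂ * 1 := mul_le_mul_of_nonneg_left hmG1 hK₂pos.le
    linarith
  have h1δ : 0 < 1 - δ₀ := by linarith
  set M : ℝ := Real.exp (2 * δ₀) / (1 - δ₀) with hMdef
  have hK₁M : K₁ ≤ M := by
    rw [hMdef, le_div_iff₀ h1δ]
    calc K₁ * (1 - δ₀) ≤ K₁ * K₂ := mul_le_mul_of_nonneg_left hK₂lb hK₁pos.le
      _ = Real.exp (2 * δ₀) := hK₁K₂
  have hK₂M : K₂ ≤ M := by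
    rw [hMdef, le_div_iff₀ h1δ]
    calc K₂ * (1 - δ₀) ≤ K₂ * K₁ := mul_le_mul_of_nonneg_left hK₁lb hK₂pos.le
      _ = Real.exp (2 * δ₀) := by rw [mul_comm, hK₁K₂]
  have hM1 : M - 1 ≤ 10 * δ₀ := exp_two_mul_div_sub_one_le hδ₀nn hδ₀half
  have hM0 : 0 ≤ M - 1 := by
    have hexp1 : 1 ≤ Real.exp (2 * δ₀) := Real.one_le_exp (by linarith)
    have : 1 ≤ M := by
      rw [hMdef, le_div_iff₀ h1δ]
      linarith
    linarith
  -- §6 the window part of `A`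
  obtain ⟨hAK₁, hAK₂⟩ := hint A hA
  have hx1 : μ'.real (A ∩ G) ≤ 1 := measureReal_le_one
  have hy1 : μ.real (A ∩ G) ≤ 1 := measureReal_le_one
  have hx0 : 0 ≤ μ'.real (A ∩ G) := measureReal_nonneg
  have hy0 : 0 ≤ μ.real (A ∩ G) := measureReal_nonneg
  have hup : μ.real (A ∩ G) - μ'.real (A ∩ G) ≤ 10 * δ₀ := by
    have h1 : μ.real (A ∩ G) ≤ M * μ'.real (A ∩ G) := hAK₁.trans (mul_le_mul_of_nonneg_right hK₁M hx0)
    have h2 : (M - 1) * μ'.real (A ∩ G) ≤ (M - 1) * 1 := mul_le_mul_of_nonneg_left hx1 hM0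
    have h3 : M * μ'.real (A ∩ G) = (M - 1) * μ'.real (A ∩ G) + μ'.real (A ∩ G) := by ring
    linarith
  have hdown : μ'.real (A ∩ G) - μ.real (A ∩ G) ≤ 10 * δ₀ := by
    have h1 : μ'.real (A ∩ G) ≤ M * μ.real (A ∩ G) := hAK₂.trans (mul_le_mul_of_nonneg_right hK₂M hy0)
    have h2 : (M - 1) * μ.real (A ∩ G) ≤ (M - 1) * 1 := mul_le_mul_of_nonneg_left hy1 hM0
    have h3 : M * μ.real (A ∩ G) = (M - 1) * μ.real (A ∩ G) + μ.real (A ∩ G) := by ring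
    linarith
  -- §7 the tail part of `A`
  have hdiff : μ.real (A \ G) ≤ δ₀ := (measureReal_mono (Set.sdiff_subset_compl A G)).trans htailR
  have hdiff' : μ'.real (A \ G) ≤ δ₀ := (measureReal_mono (Set.sdiff_subset_compl A G)).trans htailR'
  have hd0 : 0 ≤ μ.real (A \ G) := measureReal_nonneg
  have hd0' : 0 ≤ μ'.real (A \ G) := measureReal_nonneg
  have hsplit : μ.real A = μ.real (A ∩ G) + μ.real (A \ G) := (measureReal_inter_add_sdiff (μ := μ) (s := A) hG).symm
  have hsplit' : μ'.real A = μ'.real (A ∩ G) + μ'.real (A \ G) := (measureReal_inter_add_sdiff (μ := μ') (s := A) hG).symm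
  rw [hsplit, hsplit', abs_le]
  constructor <;> linarith

end Summit.QuantumFields.YangMills.Theorems.FlatRatioTermination
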